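import Summits.ABC.IUTFork.Joshi.ATS4GenuineResidualSUnitFibres
import Summits.ABC.IUTFork.LDHSUnitFamilySzpiroGuard
import HarnessLib

/-!
# [J-IV] (arXiv:2403.10430v2) §6.10–§6.11 at GENUINE components: the two fibre sums at the prime `7` over the S-unit points
# `P_{a,c}` of the `λ`-line — `q₇ = 2c·log 7` exactly, `d₇ ≤ log 7` on the whole `ℓ`-division tower (`ℓ ≠ 7`), and
# `log q^{∤{2,5}}(λ_{a,c}) = 2c·log 7` (R-J row Y-21 PARENT, rider (r4); E ROW R-27, the edge `ℓ = 5`)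

Proof-only companion (0 defs) of the abc-iut cell, sub-cell R-J «JOSHI Y-DISCHARGE CENSUS» (rung LADDER-ABC:A2.RESCUE.J; table of record
`HOME/plan/E/R-J/Y-CENSUS.tsv`, row Y-21 PARENT), seat abc-iut-E-t35 (gen 12), E ROW R-27 (`HOME/plan/E/R-J/E-ROWS.md` §E; WAKE
`HOME/abc-iut-E-t35/WAKE-R-27.md`). The `p₀ = 7` twin of this seat's gen-9 `ATS4GenuineResidualSUnitFibres` (p479649, `p₀ = 5`): the GENUINE
ARITHMETIC at the prime `7` over the tree's S-unit quadratic family `SUnitFamily.Pt a c = (ℚ(√(5^{2a}+4·7^{2c})), θ/7^c)` (abc-iut-s2-p4,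
`LDHSUnitFamily*.lean`: poles of `j(λ)` are `2a·𝔭₁ + 2c·𝔮₁ + 2c·𝔮₂` — BOTH places `𝔮₁, 𝔮₂ ∣ 7` are poles, `7` SPLIT in `F_{a,c}`), which the
sequel `ATS4DescentSpineGenuineResidualUnsatEllFive` feeds into E-t50's `not_exists_volumes_of_localExcess` (p470440) at the edge `ℓ = 5`
of the Y-21 PARENT word (there `S = {2, ℓ} = {2, 5}` swallows the pole over `5`, so the prime carrying the `q`-mass must be `7`):

* `SUnitResidual.dSeven_le` — on the genuine tower `F_{a,c} ⊆ F` (theta field: `[F:F_{a,c}] ∣ 46080 = 2¹⁰·3²·5`, Galois; `7 ∤ 46080`)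
  `⊆ K` (Galois over `F` inside `F(E_F[ℓ])`, `ℓ ≠ 7`: TAME above `7` by the tree's `ThetaTower.hKtame` = [IUTchIV] Prop. 1.8 (vii)) the
  genuine `7`-component of `log(d_{L′})` is `≤ log 7` — for EVERY prime `ℓ ≠ 7` and every bookkeeping set `D_K`;
* `SUnitResidual.qSeven_eq` — the genuine `7`-component of `log(q)` over any `M ⊇ F_{a,c}` and any `S = {2, ℓ}`, `ℓ ≠ 7`, is EXACTLY
  `2c·log 7` (both fibres, pull-back `ord_w(q_w) = e(w|𝔮ᵢ)·2c`, `Σ_{w|𝔮ᵢ} e_w f_w = [M:F_{a,c}]`); `exists_mem_V_residueChar_eq_seven` —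
  `Supp(𝔮_M)` has a place of residue characteristic `7`, so `7 ∈ V^dst_ℚ` under the support binder of `abc_of_genuineResidualSupport`;
* `SUnitResidual.logQAvoid_two_five_eq` — `log q^{∤{2,5}}(λ_{a,c}) = 2c·log 7` (the tree's `SUnitFamily.logQAvoid_eq` covers only `S ∌ 5, 7`).

SOURCE locators: [J-IV] Prop. 6.10.9 p.69 l.1–28 ([IUTchIV] Step (v) per `v_ℚ ∈ V^dst_ℚ`), (6.11.1) p.69 l.73–p.70 l.3, p.70 l.4–29
(component sums); [IUTchIV] Prop. 1.3 p.12, Prop. 1.8 (vii) p.19, Def. 1.9 (i) p.22, Cor. 2.2 (ii) proof (P5) p.46 (render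
`HOME/lit/renders/Joshi-arxiv-2403.10430/`, kurims `book:anonnd-inter-universal-teichmuller-theory-iv`). FRAMING (binding): classical Dedekind
theory composed with the tree's PROVED tameness of the division tower; NO side taken on [IUTchIII] Cor. 3.12 / [IUTchIV] Thm. 1.10, on
Joshi's claims or on Mochizuki's report; NOT an abc claim; typed ≠ proved ≠ endorsed. Theorems only; standard axioms.
[claim: Joshi2024ATS4, status: disputed] (locators).
-/

noncomputable section

namespace Summit.ABC.IUTFork.Joshi.ATS4

open NumberField IsDedekindDomain Finset
open Literature.IUT.LogVolume Literature.IUT.LogVolume.Cor22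
open Literature.NumberTheory.DiophantineGeometry.GenEll
open Literature.NumberTheory.NumberFields
open Summit.ABC.IUTFork.SUnitFamily
open scoped Classical

namespace SUnitResidual

variable {a c : ℕ} (ha : 1 ≤ a) (hc : 1 ≤ c)

include ha hc

/-! ## 1. The genuine `7`-components of `log(d_{L′})` and `log(q)` over the S-unit points `P_{a,c}` -/

/-- Every place of `F_{a,c}` over the SPLIT prime `7` is unramified over `ℚ`: `ord_v 𝔇_{F_{a,c}/ℤ} = 0` (`n_v = 1` at `𝔮₁, 𝔮₂`).
[cite: NeukirchANT1999, Ch. III (2.6)] -/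
theorem multiplicity_differentIdeal_F_eq_zero_seven (v : HeightOneSpectrum (𝓞 (F a c))) (hv : v ∈ placesOver (F a c) 7) :
    multiplicity v.asIdeal (differentIdeal ℤ (𝓞 (F a c))) = 0 := by
  haveI : Fact (Nat.Prime 7) := ⟨by norm_num⟩
  obtain ⟨-, -, 𝔮₁, 𝔮₂, -, -, ⟨k1, -, k17, -⟩, ⟨k2, -, k27, -⟩⟩ := exists_four_places ha hc
  have hdeg := localDegree_pair_eq_one (p := 7) k1 k2 k17 k27
  have hone : localDegree (F a c) v = 1 := by
    rw [placesOver_eq_pair (p := 7) k1 k2 k17 k27, Finset.mem_insert, Finset.mem_singleton] at hv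
    rcases hv with rfl | rfl
    · exact hdeg.1
    · exact hdeg.2
  have hram : ramIdx (F a c) v = 1 := Nat.eq_one_of_mul_eq_one_right hone
  rw [ramIdx_eq] at hram
  exact multiplicity_absDifferent_eq_zero_of_ramificationIdx_eq_one v hram

/-- **`d₇ ≤ log 7` on the genuine tower over `P_{a,c}`.** For a theta field `F ⊇ F_{a,c}` and `K ⊇ F` Galois inside `F(E_F[ℓ])` (via `ψ`),
`ℓ` prime `≠ 7`, and ANY finite set `D_K` of places of `K`: the genuine `7`-component `(1/[K:ℚ])·Σ_{u ∈ D_K, p_u = 7} ord_u(𝔡_K)·log N(u)` of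
`log(d_{L′})` is `≤ log 7`. Per place `ord_u 𝔡_K + 1 ≤ e(u|7)`: `F_{a,c}` unramified at the split prime `7`
(`multiplicity_differentIdeal_int_eq_add_mul`), Dedekind–Hensel for the Galois layer `F/F_{a,c}` (`[F:F_{a,c}] ∣ 46080`, `v₇(46080) = 0`:
`multiplicity_differentIdeal_tower_succ_le_of_not_dvd_top`), top layer `K/F` tame above `7 ≠ ℓ` (`ThetaTower.hKtame`); `Σ_{u|7} e_u f_u = [K:ℚ]`.
[cite: Mochizuki2012, IUTchIV Prop. 1.3 p. 12] -/
theorem dSeven_le {F : Type} [Field F] [NumberField F] [Algebra (Pt a c).F F] {K : Type} [Field K] [NumberField K]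
    [Algebra F K] [Algebra (Pt a c).F K] [IsScalarTower (Pt a c).F F K] (ψ : K →ₐ[F] AlgebraicClosure F) (hU : (Pt a c).InU)
    (hF : IsThetaField (Pt a c) F) [IsGalois F K] {ℓ : ℕ} (hℓ : ℓ.Prime) (hℓ7 : ℓ ≠ 7)
    (hK : letI := thetaCurve_isElliptic hU F
      ((thetaCurve (Pt a c) F).galoisRepTorsion (ℓ : ℤ)).ker ≤ ψ.fieldRange.fixingSubgroup)
    (DK : Finset (HeightOneSpectrum (𝓞 K))) :
    (Module.finrank ℚ K : ℝ)⁻¹ * ∑ u ∈ DK with residueChar K u = 7, differentDivisor K (Sum.inr u) * logNorm K u ≤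
      Real.log 7 := by
  haveI : Fact (Nat.Prime 7) := ⟨by norm_num⟩
  haveI : IsGalois (Pt a c).F F := hF.isGalois
  have hKpos : (0 : ℝ) < Module.finrank ℚ K := by exact_mod_cast Module.finrank_pos
  have hfac : (46080 : ℕ).factorization 7 = 0 := Nat.factorization_eq_zero_of_not_dvd (by norm_num)
  -- per place over `7`: `ord_u 𝔡_K + 1 ≤ e(u|7)`
  have hper : ∀ u ∈ placesOver K 7, multiplicity u.asIdeal (differentIdeal ℤ (𝓞 K)) + 1 ≤ ramIdx K u := by
    intro u hu
    have hres : residueChar K u = 7 := (mem_placesOver_iff_residueChar u).mp hu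
    haveI : u.asIdeal.IsMaximal := u.isMaximal
    rw [ramIdx_eq, multiplicity_differentIdeal_int_eq_add_mul (Pt a c).F K u,
      multiplicity_differentIdeal_F_eq_zero_seven ha hc _ ((mem_placesOver_iff_residueChar _).mpr (by
        rw [residueChar_finBelow, hres])), mul_zero, add_zero]
    have htame := ThetaTower.hKtame ψ hU hF hℓ hK u (by rw [hres]; exact hℓ7.symm)
    have h := multiplicity_differentIdeal_tower_succ_le_of_not_dvd_top (Pt a c).F F K u.asIdeal (M := 46080)
      (by norm_num) (by have := ThetaTower.hdvd hF; norm_num at this; exact this) htame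
    have hres' : Ideal.absNorm (u.asIdeal.under ℤ) = 7 := hres
    rw [hres', hfac] at h
    linarith
  -- sum over `D_K ∩ {p_u = 7} ⊆ V(K)_7`
  have hsub : DK.filter (fun u => residueChar K u = 7) ⊆ placesOver K 7 := fun u hu =>
    (mem_placesOver_iff_residueChar u).mpr (Finset.mem_filter.mp hu).2
  have hle := Finset.sum_le_sum_of_subset_of_nonneg hsub
    (f := fun u => differentDivisor K (Sum.inr u) * logNorm K u) (fun u _ _ => differentDivisor_mul_logNorm_nonneg K u)
  have hterm : ∀ u ∈ placesOver K 7, differentDivisor K (Sum.inr u) * logNorm K u ≤ Real.log 7 * localDegree K u := by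
    intro u hu
    have hres : residueChar K u = 7 := (mem_placesOver_iff_residueChar u).mp hu
    rw [differentDivisor_apply_inr, logNorm_eq, hres, localDegree]
    have h := hper u hu
    have h' : (multiplicity u.asIdeal (differentIdeal ℤ (𝓞 K)) : ℝ) ≤ ramIdx K u := by exact_mod_cast (by omega)
    have hf : (0 : ℝ) ≤ resDeg K u := Nat.cast_nonneg _
    have hl : (0 : ℝ) ≤ Real.log 7 := Real.log_nonneg (by norm_num)
    push_cast
    nlinarith [mul_nonneg hf hl]
  have hsum : ∑ u ∈ placesOver K 7, differentDivisor K (Sum.inr u) * logNorm K u ≤ Real.log 7 * Module.finrank ℚ K := by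
    refine (Finset.sum_le_sum hterm).trans ?_
    rw [← Finset.mul_sum, ← Nat.cast_sum, sum_localDegree K 7]
  rw [inv_mul_le_iff₀ hKpos]
  linarith

omit ha in
/-- A pole `𝔮 ∣ 7` of `j(λ_{a,c})` (order `2c`) lies in `Supp(𝔮_{F_{a,c}})` away from `S = {2, ℓ}` for every prime `ℓ ≠ 7`
(`p_𝔮 = 7 ∉ {2, ℓ}`). [cite: Mochizuki2012, IUTchIV Cor 2.2 (ii) proof (P5) p.46] -/
theorem pole_seven_mem_ofNFPoint_V {ℓ : ℕ} (hℓ : ℓ.Prime) (hℓ7 : ℓ ≠ 7) {𝔮 : HeightOneSpectrum (𝓞 (F a c))}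
    (h7 : ((7 : ℕ) : 𝓞 (F a c)) ∈ 𝔮.asIdeal) (hord : ord (F a c) 𝔮 (jInv (lam a c)) = -(2 * (c : ℤ))) :
    -- (`c ≥ 1`: the order `−2c` is negative)
    𝔮 ∈ (TateDivisorDatum.ofNFPoint (Pt a c) {2, ℓ}).V := by
  haveI : Fact (Nat.Prime 7) := ⟨by norm_num⟩
  have hres : residueChar (F a c) 𝔮 = 7 := (mem_placesOver_iff_residueChar 𝔮).mp (mem_placesOver_of_natCast_mem 7 𝔮 h7)
  rw [TateDivisorDatum.mem_ofNFPoint_V]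
  refine ⟨(mem_badPlaces_iff_ord_neg (Pt a c) 𝔮).mpr (by change ord (F a c) 𝔮 (jInv (lam a c)) < 0; omega), fun p hp => ?_⟩
  have hp' : p = 2 ∨ p = ℓ := by simpa using hp
  rw [natCast_mem_asIdeal_iff_residueChar_eq 𝔮 (by rcases hp' with rfl | rfl; exacts [Nat.prime_two, hℓ])]
  change residueChar (F a c) 𝔮 ≠ p
  omega

/-- Over any finite `M ⊇ F_{a,c}`, `Supp(𝔮_M)` (away from `{2, ℓ}`, `ℓ ≠ 7` prime) contains a place of residue characteristic `7` — so `7`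
lies in every `V^dst_ℚ` containing the residue characteristics of `Supp(𝔮_M)` (the binder `hbad` of `abc_of_genuineResidualSupport`).
[cite: Mochizuki2012, IUTchIV Thm. 1.10 p. 23] -/
theorem exists_mem_V_residueChar_eq_seven {ℓ : ℕ} (hℓ : ℓ.Prime) (hℓ7 : ℓ ≠ 7) (M : Type) [Field M] [NumberField M]
    [Algebra (Pt a c).F M] : ∃ w ∈ (TateDivisorDatum.ofNFPointOver (Pt a c) {2, ℓ} M).V, residueChar M w = 7 := by
  haveI : Fact (Nat.Prime 7) := ⟨by norm_num⟩
  obtain ⟨-, -, 𝔮₁, -, -, -, ⟨-, k1', k17, ko1⟩, -⟩ := exists_four_places ha hc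
  obtain ⟨w, hw⟩ := PlaceSection.exists_under_eq (K := M) 𝔮₁
  have hfb : finBelow (F a c) M w = 𝔮₁ := (HeightOneSpectrum.ext rfl).trans hw
  refine ⟨w, (TateDivisorDatum.mem_ofNFPointOver_V_iff (Pt a c) {2, ℓ} M w).mpr ?_, ?_⟩
  · change finBelow (F a c) M w ∈ _
    rw [hfb]; exact pole_seven_mem_ofNFPoint_V hc hℓ hℓ7 k17 (ord_at_q1 hc k17 k1' ko1)
  · rw [← residueChar_finBelow (F := F a c), hfb]
    exact (mem_placesOver_iff_residueChar 𝔮₁).mp (mem_placesOver_of_natCast_mem 7 𝔮₁ k17)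

/-- **`q₇ = 2c·log 7` EXACTLY** over every finite `M ⊇ F_{a,c}` and every `S = {2, ℓ}`, `ℓ ≠ 7` prime: the genuine `7`-component
`(1/[M:ℚ])·Σ_{w ∈ Supp 𝔮_M, p_w = 7} ord_w(q_w)·log N(w)` of `log(q)` — every place of `M` over `7` lies over one of the poles `𝔮₁, 𝔮₂`
(BOTH of order `2c`), `ord_w(q_w) = e(w|𝔮ᵢ)·2c` (pull-back, [J-IV] (4.4.6) / `Cor22.localHeight_of_algebraMap`), and
`Σ_{w|𝔮ᵢ} e(w|𝔮ᵢ)·log N(w) = [M:F_{a,c}]·log 7` for `i = 1, 2`. [cite: Mochizuki2012, IUTchIV Def. 1.9 (i) p. 22] -/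
theorem qSeven_eq {ℓ : ℕ} (hℓ : ℓ.Prime) (hℓ7 : ℓ ≠ 7) (M : Type) [Field M] [NumberField M] [Algebra (Pt a c).F M] :
    (Module.finrank ℚ M : ℝ)⁻¹ *
      ∑ w ∈ (TateDivisorDatum.ofNFPointOver (Pt a c) {2, ℓ} M).V with residueChar M w = 7,
        (TateDivisorDatum.ofNFPointOver (Pt a c) {2, ℓ} M).tateDivisor (Sum.inr w) * logNorm M w = 2 * c * Real.log 7 := by
  haveI : Fact (Nat.Prime 7) := ⟨by norm_num⟩
  obtain ⟨-, -, 𝔮₁, 𝔮₂, -, -, ⟨k1, k1', k17, ko1⟩, ⟨k2, k2', k27, ko2⟩⟩ := exists_four_places ha hc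
  set 𝔮M := TateDivisorDatum.ofNFPointOver (Pt a c) {2, ℓ} M with h𝔮M
  have hq1over : 𝔮₁ ∈ placesOver (F a c) 7 := mem_placesOver_of_natCast_mem 7 𝔮₁ k17
  have hq2over : 𝔮₂ ∈ placesOver (F a c) 7 := mem_placesOver_of_natCast_mem 7 𝔮₂ k27
  have hord1 : ord (F a c) 𝔮₁ (jInv (lam a c)) = -(2 * (c : ℤ)) := ord_at_q1 hc k17 k1' ko1
  have hord2 : ord (F a c) 𝔮₂ (jInv (lam a c)) = -(2 * (c : ℤ)) := ord_at_q2 hc k27 k2 ko2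
  have hV1 : 𝔮₁ ∈ (TateDivisorDatum.ofNFPoint (Pt a c) {2, ℓ}).V := pole_seven_mem_ofNFPoint_V hc hℓ hℓ7 k17 hord1
  have hV2 : 𝔮₂ ∈ (TateDivisorDatum.ofNFPoint (Pt a c) {2, ℓ}).V := pole_seven_mem_ofNFPoint_V hc hℓ hℓ7 k27 hord2
  have hqq : 𝔮₁ ≠ 𝔮₂ := fun h => k2 (h ▸ k1)
  -- Step 1: the index set is the union of the two fibres
  have hset : 𝔮M.V.filter (fun w => residueChar M w = 7) =
      (placesOver M 7).filter (fun w => finBelow (F a c) M w = 𝔮₁) ∪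
        (placesOver M 7).filter (fun w => finBelow (F a c) M w = 𝔮₂) := by
    ext w
    rw [Finset.mem_union, Finset.mem_filter, Finset.mem_filter, Finset.mem_filter, mem_placesOver_iff_residueChar, h𝔮M,
      TateDivisorDatum.mem_ofNFPointOver_V_iff]
    constructor
    · rintro ⟨-, hres⟩
      have hv7 : finBelow (F a c) M w ∈ placesOver (F a c) 7 := by
        rw [mem_placesOver_iff_residueChar, residueChar_finBelow, hres]
      rw [placesOver_eq_pair (p := 7) k1 k2 k17 k27, Finset.mem_insert, Finset.mem_singleton] at hv7
      rcases hv7 with h | h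
      · exact Or.inl ⟨hres, h⟩
      · exact Or.inr ⟨hres, h⟩
    · rintro (⟨hres, hw⟩ | ⟨hres, hw⟩)
      · refine ⟨?_, hres⟩
        change finBelow (F a c) M w ∈ _
        rw [hw]; exact hV1
      · refine ⟨?_, hres⟩
        change finBelow (F a c) M w ∈ _
        rw [hw]; exact hV2
  have hdisj : Disjoint ((placesOver M 7).filter (fun w => finBelow (F a c) M w = 𝔮₁))
      ((placesOver M 7).filter (fun w => finBelow (F a c) M w = 𝔮₂)) := by
    rw [Finset.disjoint_filter]
    intro w _ h1 h2
    exact hqq (h1.symm.trans h2)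
  -- Step 2: the summand on either fibre is `2c·(e(w|𝔮ᵢ)·log N(w))`
  have hloc : ∀ {𝔮 : HeightOneSpectrum (𝓞 (F a c))}, ord (F a c) 𝔮 (jInv (lam a c)) = -(2 * (c : ℤ)) →
      localHeight (Pt a c) 𝔮 = 2 * c := by
    intro 𝔮 hord
    rw [localHeight_eq_neg_ord ((mem_badPlaces_iff_ord_neg (Pt a c) 𝔮).mpr (by
      change ord (F a c) 𝔮 (jInv (lam a c)) < 0; omega))]
    change -((ord (F a c) 𝔮 (jInv (lam a c)) : ℤ) : ℝ) = _
    rw [hord]; push_cast; ring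
  have hterm : ∀ {𝔮 : HeightOneSpectrum (𝓞 (F a c))}, ord (F a c) 𝔮 (jInv (lam a c)) = -(2 * (c : ℤ)) →
      𝔮 ∈ (TateDivisorDatum.ofNFPoint (Pt a c) {2, ℓ}).V →
      ∀ w ∈ (placesOver M 7).filter (fun w => finBelow (F a c) M w = 𝔮),
        𝔮M.tateDivisor (Sum.inr w) * logNorm M w = 2 * c * ((pullbackWeight (F a c) M (Sum.inr w) : ℝ) * degWeight M (Sum.inr w)) := by
    intro 𝔮 hord hV w hw
    have hw1 : finBelow (F a c) M w = 𝔮 := (Finset.mem_filter.mp hw).2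
    have hwV : w ∈ 𝔮M.V := by
      rw [h𝔮M, TateDivisorDatum.mem_ofNFPointOver_V_iff]
      change finBelow (F a c) M w ∈ _
      rw [hw1]; exact hV
    rw [𝔮M.tateDivisor_apply_inr, if_pos hwV, h𝔮M]
    letI : Algebra (Pt a c).F (extend (Pt a c) M).F := ‹Algebra (Pt a c).F M›
    rw [TateDivisorDatum.ordq_ofNFPoint_cast, localHeight_of_algebraMap (P := Pt a c) (Q := extend (Pt a c) M) rfl w]
    change ((finBelow (F a c) M w).asIdeal.ramificationIdx' w.asIdeal : ℝ) * localHeight (Pt a c) (finBelow (F a c) M w) *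
      logNorm M w = 2 * c * (((finBelow (F a c) M w).asIdeal.ramificationIdx' w.asIdeal : ℝ) * logNorm M w)
    rw [hw1, hloc hord]; ring
  -- Step 3: the fibre identity `Σ_{w|𝔮ᵢ} e(w|𝔮ᵢ)·log N(w) = [M:F_{a,c}]·log 7`, `i = 1, 2`
  have hlog := weight_pair_eq_half (p := 7) k1 k2 k17 k27
  have hfib : ∀ {𝔮 : HeightOneSpectrum (𝓞 (F a c))}, 𝔮 ∈ placesOver (F a c) 7 → logNorm (F a c) 𝔮 = Real.log 7 →
      ∑ w ∈ (placesOver M 7).filter (fun w => finBelow (F a c) M w = 𝔮),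
        ((pullbackWeight (F a c) M (Sum.inr w) : ℝ) * degWeight M (Sum.inr w)) = Module.finrank (F a c) M * Real.log 7 := by
    intro 𝔮 hover hlog𝔮
    have h := sum_pullbackWeight_mul_degWeight_inr (F := F a c) (K := M) 𝔮
    rw [← filter_finBelow_eq_placesAbove (F a c) M 𝔮 hover, Finset.sum_map, degWeight_inr, hlog𝔮] at h
    exact h
  rw [hset, Finset.sum_union hdisj, Finset.sum_congr rfl (hterm hord1 hV1), Finset.sum_congr rfl (hterm hord2 hV2),
    ← Finset.mul_sum, ← Finset.mul_sum, hfib hq1over hlog.1.2, hfib hq2over hlog.2.2,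
    finrank_rat_eq_mul (F := F a c) (K := M), finrank_F a c]
  have hMpos : (0 : ℝ) < Module.finrank (F a c) M := by exact_mod_cast Module.finrank_pos
  field_simp
  ring

/-! ## 2. The total `log 𝔮_F` at `S = {2, 5}` -/

/-- **`log q^{∤{2,5}}(λ_{a,c}) = 2c·log 7` EXACTLY**: at `ℓ = 5` the set `S = {2, ℓ}` swallows the pole `𝔭₁ ∣ 5`, and the surviving poles
are `2c·𝔮₁ + 2c·𝔮₂` (`N𝔮ᵢ = 7`, `[F_{a,c}:ℚ] = 2`). [cite: Mochizuki2012, IUTchIV Cor 2.2 (ii) proof (P5) p.46] -/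
theorem logQAvoid_two_five_eq : logQAvoid (Pt a c) {2, 5} = 2 * (c : ℝ) * Real.log 7 := by
  haveI : Fact (Nat.Prime 5) := ⟨by norm_num⟩
  haveI : Fact (Nat.Prime 7) := ⟨by norm_num⟩
  obtain ⟨𝔭₁, 𝔭₂, 𝔮₁, 𝔮₂, H₁, H₂, K₁, K₂⟩ := exists_four_places ha hc
  have h := degree_mul_logQAvoid (Pt a c) {2, 5}
  -- the filtered bad set is `{𝔮₁, 𝔮₂}`
  have hset : (badPlaces (Pt a c)).filter (fun v => ∀ p ∈ ({2, 5} : Finset ℕ), ((p : ℕ) : 𝓞 (Pt a c).F) ∉ v.asIdeal) = {𝔮₁, 𝔮₂} := by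
    ext v
    rw [Finset.mem_filter, badPlaces_eq ha hc H₁ H₂ K₁ K₂, Finset.mem_insert, Finset.mem_insert, Finset.mem_singleton]
    constructor
    · rintro ⟨h | h | h, hS⟩
      · exact absurd H₁.2.2.1 (h ▸ hS 5 (by simp))
      · exact Or.inl h
      · exact Or.inr h
    · intro hv
      have h7 : ((7 : ℕ) : 𝓞 (F a c)) ∈ v.asIdeal := by rcases hv with rfl | rfl; exacts [K₁.2.2.1, K₂.2.2.1]
      refine ⟨by rcases hv with rfl | rfl <;> simp, fun p hp => ?_⟩
      have hp' : p = 2 ∨ p = 5 := by simpa using hp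
      have hpp : p.Prime := by rcases hp' with rfl | rfl <;> norm_num
      exact SplitDepth.natCast_not_mem_of_prime_ne ⟨v, mem_placesOver_of_natCast_mem 7 v h7⟩ hpp (by omega)
  have hqq : 𝔮₁ ≠ 𝔮₂ := fun h => K₂.1 (h ▸ K₁.1)
  rw [hset, Finset.sum_pair hqq] at h
  have hbad := badPlaces_eq ha hc H₁ H₂ K₁ K₂
  have m2 : 𝔮₁ ∈ badPlaces (Pt a c) := by rw [hbad]; simp
  have m3 : 𝔮₂ ∈ badPlaces (Pt a c) := by rw [hbad]; simp
  rw [localHeight_eq_neg_ord m2, localHeight_eq_neg_ord m3] at h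
  have o2 : ord (Pt a c).F 𝔮₁ (jInv (Pt a c).x) = -(2 * (c : ℤ)) := ord_at_q1 hc K₁.2.2.1 K₁.2.1 K₁.2.2.2
  have o3 : ord (Pt a c).F 𝔮₂ (jInv (Pt a c).x) = -(2 * (c : ℤ)) := ord_at_q2 hc K₂.2.2.1 K₂.1 K₂.2.2.2
  have e7 := weight_pair_eq_half (p := 7) K₁.1 K₂.1 K₁.2.2.1 K₂.2.2.1
  rw [o2, o3] at h
  change _ = -((-(2 * (c : ℤ)) : ℤ) : ℝ) * logNorm (F a c) 𝔮₁ + -((-(2 * (c : ℤ)) : ℤ) : ℝ) * logNorm (F a c) 𝔮₂ at h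
  rw [e7.1.2, e7.2.2, degree_Pt_real] at h
  push_cast at h
  linarith

end SUnitResidual

end Summit.ABC.IUTFork.Joshi.ATS4

end
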